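import Mathlib
import Summits.NavierStokesRegularity.OSWSelfSimilar.SheetNSLineCornerRealPart
import Summits.NavierStokesRegularity.OSWSelfSimilar.SheetNSLineLinearCoreTail
import Literature.Analysis.Fourier.HilbertTransformLineVelocityBound
import HarnessLib

/-!
# Viscous gCLM/OSW profile MODEL: THE CENSUS DECAY CLASS IS AUTOMATIC — the four tail/decay binders of the
# a-axis census decls are THEOREMS inside the bare census class

HONEST FRAMING (cell ns-blowup GROUP B «PROFILE SEARCH», zone Z3 = the 1-D viscous gCLM/OSW sheet; human rulings
D-0035/D-0074): **1-D MODEL; one-variable real analysis kernel-checked; not Euler, not Navier–Stokes; «violates: none —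
MODEL».** Nothing in this file is a statement about Navier–Stokes.

THE CLASS («bare census class» of CENSUS-Z3 row Z3-E12⁻ clause (i′)): an odd `C²` profile `Ω` on `ℝ` (`Ω′ = dOm`,
`Ω″ = ddOm`) with the slope bound `|Ω′| ≤ M`, the envelope `|Ω(ξ)| ≤ C/(1+ξ²)`, and the MODEL velocity `𝒰` with
`𝒰′ = HΩ` (GENUINE `hilbertTransform`), `𝒰(0) = 0`; on the NS-type line `c_l = c_ω/2` (`c_ω > 0`) the profile equation is
`F₁(c_ω, c_ω/2, a, b = 1, ε; HΩ, 𝒰, Ω) ≡ 0` on `(0,∞)`, i.e. `εΩ″ = c_ωΩ + (c_ω/2)ξΩ′ + a𝒰Ω′ − (HΩ)Ω`.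
The census decls `nsTypeLine_ESigned_empty_of_a_neg` (p540197), `nsTypeLine_tail_pos_of_a_neg` /
`nsTypeLine_empty_of_a_neg_of_eventually_nonpos` (p547035), `nsTypeLine_empty_of_a_eq_zero` (p550887) and
`nsTypeLine_empty_of_a_le_neg_one` (p553993) carry, besides the class, up to four DECAY BINDERS:
`iUOm : 𝒰Ω ∈ L¹(0,∞)`, `iH : ξ(HΩ)Ω ∈ L¹(0,∞)`, `hUOm : ξ𝒰(ξ)Ω(ξ) → 0`, `hdOm1 : ξΩ′(ξ) → 0`.

WHAT IS KERNEL-CHECKED HERE: all four are consequences of the class.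
* `decay_iH` — **`ξ(HΩ)Ω ∈ L¹(0,∞)`**, equation-free: `ξ·HΩ ∈ L²` by the weighted isometry of the tree
  (`integral_weight_mul_hilbertTransform_sq_eq_of_memLp`: odd `Ω`, `Ω, ξΩ ∈ L²`, p.v. integrand integrable) and `Ω ∈ L²`.
* `velocity_eq_integral`, `velocity_bounded` — `𝒰 = ∫₀^ξ HΩ` is BOUNDED, `|𝒰| ≤ (π/4·∫(1+x²)Ω²)^{1/2}`
  (`sq_integral_hilbertTransform_le`), equation-free; hence `decay_iUOm` — **`𝒰Ω ∈ L¹(0,∞)`** — and `decay_hUOm` —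
  **`ξ𝒰(ξ)Ω(ξ) → 0`** (bounded `𝒰` against the envelope).
* `slope_round` — one round of the GAUSSIAN INTEGRATING FACTOR for `εΩ″ = 2bε·ξΩ′ + f` on `(0,∞)` with `Ω′` bounded:
  `|f| ≤ K/ξⁿ` ⇒ `|Ω′(ξ)| ≤ K/(2bε ξⁿ⁺¹)` (`g = e^{−bξ²}Ω′ → 0`, `g(ξ) = −∫_ξ^∞ g′`, `∫_ξ^∞ ηe^{−bη²} = e^{−bξ²}/(2b)`).
* `decay_hdOm1_of_velocityBound`, `decay_hdOm1`, `decay_hdOm1_of_a_eq_zero` — **`ξΩ′(ξ) → 0`** for every `ε ≥ 0`,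
  every `a`: for `ε > 0` two rounds of `slope_round` with `b = c_ω/(4ε)`, `f = (c_ω − HΩ)Ω + a𝒰Ω′`
  (`|HΩ| ≤ π⁻¹(2M + 2‖Ω‖₁)`, `SheetNSLineCorner.abs_hilbertTransform_le`) give `|Ω′| ≤ K₂/ξ²` on `(0,∞)`;
  for `ε = 0` the first-order equation gives `|Ω′| ≤ 4(c_ω + ‖HΩ‖_∞)C/(c_ω ξ(1+ξ²))` beyond `ξ₀ = 4|a|‖𝒰‖_∞/c_ω`;
  at `a = 0` no velocity hypothesis is needed.
The companion file `SheetNSLineBareClass.lean` re-issues the census decls with the decay binders removed.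
NOT PROVED HERE: anything for `ε < 0`; anything dynamic; anything about Euler or NS. No definitions; no `def … : Prop`
hypotheses; standard axioms.
bears_on: LADDER-NS N5 / zone Z3 row Z3-E12⁻ clause (i′) (CENSUS-Z3 v2.17 §3 caveats [g11]/[g13]) → N1 linear core.
-/

noncomputable section
open Set Filter Topology MeasureTheory
open scoped Real

namespace Summit.NavierStokesRegularity.OSWSelfSimilar
namespace SheetHalfLine
open HouLuoOriginLaws (F1)
open Literature.Analysis.Fourier

/-! ### (D1) `ξ(HΩ)Ω ∈ L¹(0,∞)` -/

/-- **(D1) `ξ(HΩ)Ω ∈ L¹(0,∞)` in the class** (odd `C¹`, envelope `|Ω| ≤ C/(1+ξ²)`): `ξ·HΩ ∈ L²` by the weighted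
isometry and `Ω ∈ L²`. Equation-free. [new here — MODEL bookkeeping] -/
theorem decay_iH {Om dOm : ℝ → ℝ} {C : ℝ} (hodd : ∀ y, Om (-y) = -Om y)
    (hOm : ∀ ξ, HasDerivAt Om (dOm ξ) ξ) (hdOmc : Continuous dOm) (hC : ∀ y, |Om y| ≤ C / (1 + y ^ 2)) :
    IntegrableOn (fun ξ => ξ * (hilbertTransform Om ξ * Om ξ)) (Ioi 0) := by
  have hc : Continuous Om := continuous_iff_continuousAt.mpr fun x => (hOm x).continuousAt
  have hΩi := integrable_of_env hc hC
  have hΩ2 := memLp_two_of_env hc hC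
  have hxH : MemLp (fun x => x * hilbertTransform Om x) 2 :=
    (integral_weight_mul_hilbertTransform_sq_eq_of_memLp hΩi hodd hΩ2 (memLp_two_id_mul_of_env hc hC)
      (integrableOn_symmIntegrand_of_hasDerivAt hOm hdOmc hΩi) 0).1
  have hI : Integrable (fun x => x * hilbertTransform Om x * Om x) := hxH.integrable_mul hΩ2
  exact (hI.congr (ae_of_all _ fun x => mul_assoc _ _ _)).integrableOn

/-! ### (D2)–(D3) the velocity is a bounded primitive -/

/-- **`𝒰(ξ) = ∫₀^ξ HΩ`** in the class (`𝒰′ = HΩ` everywhere, `𝒰(0) = 0`, `HΩ` continuous for `C¹ ∩ L¹` profiles).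
[new here — MODEL bookkeeping] -/
theorem velocity_eq_integral {Om dOm U : ℝ → ℝ} {C : ℝ} (hOm : ∀ ξ, HasDerivAt Om (dOm ξ) ξ) (hdOmc : Continuous dOm)
    (hC : ∀ y, |Om y| ≤ C / (1 + y ^ 2))
    (hU : ∀ ξ, HasDerivAt U (hilbertTransform Om ξ) ξ) (hU0 : U 0 = 0) (ξ : ℝ) :
    U ξ = ∫ t in (0:ℝ)..ξ, hilbertTransform Om t := by
  have hc : Continuous Om := continuous_iff_continuousAt.mpr fun x => (hOm x).continuousAt
  have hΩi := integrable_of_env hc hC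
  have h1 : ContDiff ℝ 1 Om := by
    rw [contDiff_one_iff_deriv]
    exact ⟨fun y => (hOm y).differentiableAt,
      by rw [show deriv Om = dOm from funext fun y => (hOm y).deriv]; exact hdOmc⟩
  have hh : Continuous (hilbertTransform Om) := SheetRWeakProfilePV.continuous_hilbertTransform_of_contDiff h1 hΩi
  have h := intervalIntegral.integral_eq_sub_of_hasDerivAt (f := U) (a := 0) (b := ξ) (fun x _ => hU x)
    (hh.intervalIntegrable 0 ξ)
  rw [h, hU0, sub_zero]

/-- **(D2) the velocity is BOUNDED in the class**: `|𝒰(ξ)| ≤ (π/4 · ∫(1+x²)Ω²)^{1/2}` for every `ξ`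
(`sq_integral_hilbertTransform_le` at `c = 1`). Equation-free. [new here — MODEL bookkeeping] -/
theorem velocity_bounded {Om dOm U : ℝ → ℝ} {C : ℝ} (hodd : ∀ y, Om (-y) = -Om y)
    (hOm : ∀ ξ, HasDerivAt Om (dOm ξ) ξ) (hdOmc : Continuous dOm) (hC : ∀ y, |Om y| ≤ C / (1 + y ^ 2))
    (hU : ∀ ξ, HasDerivAt U (hilbertTransform Om ξ) ξ) (hU0 : U 0 = 0) :
    ∃ B : ℝ, 0 ≤ B ∧ ∀ ξ, |U ξ| ≤ B := by
  have hc : Continuous Om := continuous_iff_continuousAt.mpr fun x => (hOm x).continuousAt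
  have hΩi := integrable_of_env hc hC
  set W : ℝ := π / (4 * Real.sqrt 1) * ∫ x, (1 + x ^ 2) * Om x ^ 2 with hW
  refine ⟨Real.sqrt W, Real.sqrt_nonneg _, fun ξ => ?_⟩
  have h := sq_integral_hilbertTransform_le hΩi hodd (memLp_two_of_env hc hC) (memLp_two_id_mul_of_env hc hC)
    (integrableOn_symmIntegrand_of_hasDerivAt hOm hdOmc hΩi) one_pos ξ
  rw [← velocity_eq_integral hOm hdOmc hC hU hU0 ξ] at h
  calc |U ξ| = Real.sqrt (U ξ ^ 2) := (Real.sqrt_sq_eq_abs _).symm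
    _ ≤ Real.sqrt W := Real.sqrt_le_sqrt h

/-- **(D2′) `𝒰Ω ∈ L¹(0,∞)` in the class** (bounded `𝒰`, `Ω ∈ L¹`). Equation-free. [new here — MODEL bookkeeping] -/
theorem decay_iUOm {Om dOm U : ℝ → ℝ} {C : ℝ} (hodd : ∀ y, Om (-y) = -Om y)
    (hOm : ∀ ξ, HasDerivAt Om (dOm ξ) ξ) (hdOmc : Continuous dOm) (hC : ∀ y, |Om y| ≤ C / (1 + y ^ 2))
    (hU : ∀ ξ, HasDerivAt U (hilbertTransform Om ξ) ξ) (hU0 : U 0 = 0) :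
    IntegrableOn (fun ξ => U ξ * Om ξ) (Ioi 0) := by
  obtain ⟨B, -, hB⟩ := velocity_bounded hodd hOm hdOmc hC hU hU0
  have hc : Continuous Om := continuous_iff_continuousAt.mpr fun x => (hOm x).continuousAt
  have hUc : Continuous U := continuous_iff_continuousAt.mpr fun x => (hU x).continuousAt
  have hI : Integrable (fun ξ => U ξ * Om ξ) :=
    (integrable_of_env hc hC).bdd_mul hUc.aestronglyMeasurable
      (ae_of_all _ fun x => by rw [Real.norm_eq_abs]; exact hB x)
  exact hI.integrableOn

/-- **(D3) `ξ𝒰(ξ)Ω(ξ) → 0` in the class** (bounded `𝒰`, `|ξΩ(ξ)| ≤ Cξ/(1+ξ²) ≤ C/ξ`). Equation-free.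
[new here — MODEL bookkeeping] -/
theorem decay_hUOm {Om dOm U : ℝ → ℝ} {C : ℝ} (hodd : ∀ y, Om (-y) = -Om y)
    (hOm : ∀ ξ, HasDerivAt Om (dOm ξ) ξ) (hdOmc : Continuous dOm) (hC : ∀ y, |Om y| ≤ C / (1 + y ^ 2))
    (hU : ∀ ξ, HasDerivAt U (hilbertTransform Om ξ) ξ) (hU0 : U 0 = 0) :
    Tendsto (fun R => R * U R * Om R) atTop (𝓝 0) := by
  obtain ⟨B, hB0, hB⟩ := velocity_bounded hodd hOm hdOmc hC hU hU0
  have hC0 := env_const_nonneg hC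
  have hlim : Tendsto (fun R : ℝ => B * C * R⁻¹) atTop (𝓝 0) := by
    simpa using tendsto_inv_atTop_zero.const_mul (B * C)
  refine squeeze_zero_norm' ?_ hlim
  filter_upwards [Ioi_mem_atTop (0:ℝ)] with R hR
  have hR0 : (0:ℝ) < R := hR
  rw [Real.norm_eq_abs, abs_mul, abs_mul, abs_of_pos hR0]
  have h1 : |Om R| ≤ C / R ^ 2 :=
    (hC R).trans (div_le_div_of_nonneg_left hC0 (by positivity) (by nlinarith))
  calc R * |U R| * |Om R| ≤ R * B * (C / R ^ 2) :=
        mul_le_mul (mul_le_mul_of_nonneg_left (hB R) hR0.le) h1 (abs_nonneg _) (by positivity)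
    _ = B * C * R⁻¹ := by field_simp

/-! ### One round of the Gaussian integrating factor -/

/-- `∫_ξ^∞ η e^{−bη²} dη = e^{−bξ²}/(2b)` for `ξ, b > 0`, with integrability (from the tree's
`linearCore_integral_Ioi_mul_exp_neg_sq`). [folklore] -/
theorem integral_Ioi_id_mul_exp_neg_sq {ξ b : ℝ} (hξ : 0 < ξ) (hb : 0 < b) :
    IntegrableOn (fun η : ℝ => η * Real.exp (-b * η ^ 2)) (Ioi ξ) ∧
      ∫ η in Ioi ξ, η * Real.exp (-b * η ^ 2) = Real.exp (-b * ξ ^ 2) / (2 * b) := by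
  obtain ⟨hI, hval⟩ := linearCore_integral_Ioi_mul_exp_neg_sq hξ hb
  have hξ3 : (0:ℝ) < ξ ^ 3 := by positivity
  have e : (fun η : ℝ => η * Real.exp (-b * η ^ 2)) = fun η => ξ ^ 3 * (η / ξ ^ 3 * Real.exp (-b * η ^ 2)) := by
    funext η; field_simp
  rw [e]
  refine ⟨hI.const_mul (ξ ^ 3), ?_⟩
  rw [integral_const_mul, hval]
  field_simp

/-- **ONE ROUND OF THE GAUSSIAN INTEGRATING FACTOR.** Let `b, ε > 0`, let `Ω′ = dOm` be differentiable on `ℝ` with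
derivative `ddOm` and BOUNDED (`|Ω′| ≤ M`), and on `(0,∞)` let `εΩ″ = 2bε·ξΩ′ + f` with `f` continuous there and
`|f(ξ)| ≤ K/ξⁿ`. Then `|Ω′(ξ)| ≤ K/(2bε·ξⁿ⁺¹)` on `(0,∞)`. Proof: `g := e^{−bξ²}Ω′` has `g′ = e^{−bξ²}f/ε`, `g → 0`
(bounded `Ω′`), so `g(ξ) = −∫_ξ^∞ g′` and `|g′(η)| ≤ (K/(εξⁿ⁺¹))·ηe^{−bη²}` on `(ξ,∞)`. [folklore] -/
theorem slope_round {b ε K M : ℝ} {n : ℕ} {dOm ddOm f : ℝ → ℝ} (hb : 0 < b) (hε : 0 < ε)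
    (hdOm : ∀ s, HasDerivAt dOm (ddOm s) s) (hM : ∀ s, |dOm s| ≤ M)
    (hfc : ContinuousOn f (Ioi 0))
    (heq : ∀ s ∈ Ioi (0:ℝ), ε * ddOm s = 2 * b * ε * (s * dOm s) + f s)
    (hK : ∀ s ∈ Ioi (0:ℝ), |f s| ≤ K / s ^ n) :
    ∀ ξ ∈ Ioi (0:ℝ), |dOm ξ| ≤ K / (2 * b * ε * ξ ^ (n + 1)) := by
  intro ξ hξ
  have hξ0 : (0:ℝ) < ξ := hξ
  have hK0 : 0 ≤ K := by
    have h := hK ξ hξ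
    have : 0 ≤ K / ξ ^ n := (abs_nonneg _).trans h
    exact (div_nonneg_iff.mp this).elim (fun h => h.1) fun h => absurd h.2 (not_le.mpr (pow_pos hξ0 n))
  -- the integrating factor
  set g : ℝ → ℝ := fun s => Real.exp (-b * s ^ 2) * dOm s with hg
  have hg' : ∀ s, HasDerivAt g (Real.exp (-b * s ^ 2) * (ddOm s - 2 * b * s * dOm s)) s := by
    intro s
    have h1 : HasDerivAt (fun s : ℝ => -b * s ^ 2) (-b * (2 * s)) s := by
      simpa using (hasDerivAt_pow 2 s).const_mul (-b)
    refine (h1.exp.mul (hdOm s)).congr_deriv ?_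
    ring
  have hgIoi : ∀ s ∈ Ioi ξ, HasDerivAt g (Real.exp (-b * s ^ 2) * f s / ε) s := by
    intro s hs
    have hs0 : s ∈ Ioi (0:ℝ) := hξ0.trans hs
    refine (hg' s).congr_deriv ?_
    have e : ddOm s - 2 * b * s * dOm s = f s / ε := by
      field_simp
      linear_combination heq s hs0
    rw [e]; ring
  have hgc : ContinuousWithinAt g (Ici ξ) ξ := (hg' ξ).continuousAt.continuousWithinAt
  -- `g → 0`
  have hexp0 : Tendsto (fun η : ℝ => Real.exp (-b * η ^ 2)) atTop (𝓝 0) := by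
    have h1 : Tendsto (fun η : ℝ => -b * η ^ 2) atTop atBot := by
      have := (tendsto_pow_atTop (n := 2) (α := ℝ) two_ne_zero).const_mul_atTop_of_neg (neg_lt_zero.mpr hb)
      simpa using this
    exact Real.tendsto_exp_atBot.comp h1
  have hM0 : 0 ≤ M := (abs_nonneg _).trans (hM 0)
  have hg0 : Tendsto g atTop (𝓝 0) := by
    have hl : Tendsto (fun η : ℝ => M * Real.exp (-b * η ^ 2)) atTop (𝓝 0) := by
      simpa using hexp0.const_mul M
    refine squeeze_zero_norm (fun s => ?_) hl
    rw [hg, Real.norm_eq_abs, abs_mul, abs_of_pos (Real.exp_pos _), mul_comm]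
    exact mul_le_mul_of_nonneg_right (hM s) (Real.exp_pos _).le
  -- the dominating function on `(ξ, ∞)`
  obtain ⟨hDint, hDval⟩ := integral_Ioi_id_mul_exp_neg_sq hξ0 hb
  have hdom : ∀ s ∈ Ioi ξ, ‖Real.exp (-b * s ^ 2) * f s / ε‖ ≤ K / (ε * ξ ^ (n + 1)) * (s * Real.exp (-b * s ^ 2)) := by
    intro s hs
    have hsξ : ξ < s := hs
    have hs0 : 0 < s := hξ0.trans hsξ
    rw [Real.norm_eq_abs, abs_div, abs_mul, abs_of_pos (Real.exp_pos _), abs_of_pos hε]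
    have h1 : |f s| ≤ K / ξ ^ (n + 1) * s := by
      calc |f s| ≤ K / s ^ n := hK s hs0
        _ = K * s / s ^ (n + 1) := by rw [pow_succ]; field_simp
        _ ≤ K * s / ξ ^ (n + 1) :=
            div_le_div_of_nonneg_left (by positivity) (pow_pos hξ0 _) (pow_le_pow_left₀ hξ0.le hsξ.le _)
        _ = K / ξ ^ (n + 1) * s := by ring
    calc Real.exp (-b * s ^ 2) * |f s| / ε ≤ Real.exp (-b * s ^ 2) * (K / ξ ^ (n + 1) * s) / ε := by
          gcongr
      _ = K / (ε * ξ ^ (n + 1)) * (s * Real.exp (-b * s ^ 2)) := by field_simp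
  have hcont' : ContinuousOn (fun s => Real.exp (-b * s ^ 2) * f s / ε) (Ioi ξ) :=
    ((by fun_prop : Continuous fun s : ℝ => Real.exp (-b * s ^ 2)).continuousOn.mul
      (hfc.mono (Ioi_subset_Ioi hξ0.le))).div_const _
  have hgint : IntegrableOn (fun s => Real.exp (-b * s ^ 2) * f s / ε) (Ioi ξ) := by
    refine Integrable.mono' (hDint.const_mul (K / (ε * ξ ^ (n + 1))))
      (hcont'.aestronglyMeasurable measurableSet_Ioi) ?_
    exact ae_restrict_of_forall_mem measurableSet_Ioi hdom
  -- FTC on `[ξ, ∞)` and the bound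
  have hFTC := integral_Ioi_of_hasDerivAt_of_tendsto hgc hgIoi hgint hg0
  have hgξ : |g ξ| ≤ K / (ε * ξ ^ (n + 1)) * (Real.exp (-b * ξ ^ 2) / (2 * b)) := by
    have h1 : g ξ = -∫ s in Ioi ξ, Real.exp (-b * s ^ 2) * f s / ε := by rw [hFTC]; ring
    rw [h1, abs_neg, ← Real.norm_eq_abs]
    refine (norm_integral_le_of_norm_le (hDint.const_mul (K / (ε * ξ ^ (n + 1))))
      (ae_restrict_of_forall_mem measurableSet_Ioi hdom)).trans ?_
    rw [integral_const_mul, hDval]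
  -- undo the integrating factor
  have hexpξ : 0 < Real.exp (-b * ξ ^ 2) := Real.exp_pos _
  have hgabs : |g ξ| = Real.exp (-b * ξ ^ 2) * |dOm ξ| := by
    rw [hg]; simp only; rw [abs_mul, abs_of_pos hexpξ]
  rw [hgabs] at hgξ
  rw [le_div_iff₀ (by positivity)]
  have := mul_le_mul_of_nonneg_left hgξ (show (0:ℝ) ≤ 2 * b * ε * ξ ^ (n + 1) by positivity)
  have e : 2 * b * ε * ξ ^ (n + 1) * (K / (ε * ξ ^ (n + 1)) * (Real.exp (-b * ξ ^ 2) / (2 * b)))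
      = K * Real.exp (-b * ξ ^ 2) := by field_simp
  rw [e] at this
  nlinarith [abs_nonneg (dOm ξ), hexpξ]

/-! ### (D4) `ξΩ′(ξ) → 0` -/

/-- The NS-type-line equation solved for `εΩ″` on `(0,∞)`. [new here — MODEL bookkeeping] -/
theorem nsTypeLine_eq_ddOm {cω a ε : ℝ} {U Om dOm ddOm : ℝ → ℝ}
    (hF : ∀ ξ ∈ Ioi (0:ℝ), F1 cω (cω / 2) a 1 ε (hilbertTransform Om) U Om dOm ddOm (fun _ => 0) ξ = 0)
    {s : ℝ} (hs : s ∈ Ioi (0:ℝ)) :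
    ε * ddOm s = cω / 2 * (s * dOm s) + ((cω - hilbertTransform Om s) * Om s + a * U s * dOm s) := by
  have h := hF s hs
  simp only [F1] at h
  linear_combination -h

/-- **(D4, core) `ξΩ′(ξ) → 0` on the NS-type line, given a bound `|a·𝒰| ≤ B`.** For `c_ω > 0`, `ε ≥ 0`, a `C²` profile
with `|Ω′| ≤ M`, `|Ω| ≤ C/(1+ξ²)` solving `F₁(c_ω, c_ω/2, a, 1, ε; HΩ, 𝒰, Ω) ≡ 0` on `(0,∞)` (genuine `HΩ`):
`ε > 0` — two rounds of `slope_round` (`b = c_ω/(4ε)`, `f = (c_ω − HΩ)Ω + a𝒰Ω′`, `|HΩ| ≤ π⁻¹(2M + 2‖Ω‖₁)`) give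
`|Ω′| ≤ K₂/ξ²` on `(0,∞)`; `ε = 0` — the first-order equation gives `|Ω′(ξ)| ≤ 4(c_ω + ‖HΩ‖_∞)C/(c_ω ξ(1+ξ²))` for
`ξ > 4B/c_ω`. [new here — MODEL] -/
theorem decay_hdOm1_of_velocityBound {cω a ε M C B : ℝ} {U Om dOm ddOm : ℝ → ℝ} (hcω : 0 < cω) (hε : 0 ≤ ε)
    (hOm : ∀ ξ, HasDerivAt Om (dOm ξ) ξ) (hdOm : ∀ ξ, HasDerivAt dOm (ddOm ξ) ξ)
    (hM : ∀ y, |dOm y| ≤ M) (hC : ∀ y, |Om y| ≤ C / (1 + y ^ 2))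
    (hUc : ContinuousOn U (Ioi 0)) (hB : ∀ s ∈ Ioi (0:ℝ), |a * U s| ≤ B)
    (hF : ∀ ξ ∈ Ioi (0:ℝ), F1 cω (cω / 2) a 1 ε (hilbertTransform Om) U Om dOm ddOm (fun _ => 0) ξ = 0) :
    Tendsto (fun R => R * dOm R) atTop (𝓝 0) := by
  obtain ⟨hc, hdc, hΩi, -, -, hhc, hhb⟩ := SheetNSLineCorner.corner_basic hOm hdOm hM hC
  set Mh : ℝ := π⁻¹ * (2 * M + 2 * ∫ y, |Om y|) with hMh
  have hC0 := env_const_nonneg hC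
  have hM0 : 0 ≤ M := (abs_nonneg _).trans (hM 0)
  have hMh0 : 0 ≤ Mh := (abs_nonneg _).trans (hhb 0)
  have hB0 : 0 ≤ B := (abs_nonneg _).trans (hB 1 (by norm_num : (0:ℝ) < 1))
  -- the linear part `(c_ω − HΩ)Ω` is enveloped
  have hlin : ∀ s, |(cω - hilbertTransform Om s) * Om s| ≤ (cω + Mh) * C / (1 + s ^ 2) := by
    intro s
    rw [abs_mul, mul_div_assoc]
    refine mul_le_mul ((abs_sub _ _).trans (add_le_add (le_of_eq (abs_of_pos hcω)) (hhb s))) (hC s)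
      (abs_nonneg _) (by positivity)
  -- conclusion from a bound `|Ω′(ξ)| ≤ K/ξ²` beyond some `ξ₀`
  have conclude : ∀ K ξ₀ : ℝ, (∀ ξ, ξ₀ < ξ → 0 < ξ → |dOm ξ| ≤ K / ξ ^ 2) →
      Tendsto (fun R => R * dOm R) atTop (𝓝 0) := by
    intro K ξ₀ hK
    have hlim : Tendsto (fun R : ℝ => K * R⁻¹) atTop (𝓝 0) := by
      simpa using tendsto_inv_atTop_zero.const_mul K
    refine squeeze_zero_norm' ?_ hlim
    filter_upwards [Ioi_mem_atTop ξ₀, Ioi_mem_atTop (0:ℝ)] with R hR hR0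
    have hR0' : (0:ℝ) < R := hR0
    rw [Real.norm_eq_abs, abs_mul, abs_of_pos hR0']
    calc R * |dOm R| ≤ R * (K / R ^ 2) := mul_le_mul_of_nonneg_left (hK R hR hR0') hR0'.le
      _ = K * R⁻¹ := by field_simp
  rcases hε.eq_or_lt with hε0 | hεpos
  · -- `ε = 0`: first-order equation
    subst hε0
    refine conclude (4 * (cω + Mh) * C / cω) (max (4 * B / cω) 1) fun ξ hξ' hξ0 => ?_
    have hξ : 4 * B / cω < ξ := (le_max_left _ _).trans_lt hξ'
    have hξ1 : 1 ≤ ξ := ((le_max_right _ _).trans_lt hξ').le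
    have h := hF ξ hξ0
    simp only [F1, zero_mul, sub_zero] at h
    -- `((c_ω/2)ξ + a𝒰)Ω′ = (HΩ − c_ω)Ω`
    have heq : (cω / 2 * ξ + a * U ξ) * dOm ξ = -((cω - hilbertTransform Om ξ) * Om ξ) := by linear_combination h
    have hcoef : cω / 4 * ξ ≤ |cω / 2 * ξ + a * U ξ| := by
      have h1 : |a * U ξ| ≤ B := hB ξ hξ0
      have h2 : cω / 4 * ξ > B := by
        rw [div_lt_iff₀ hcω] at hξ
        linarith
      calc cω / 4 * ξ ≤ cω / 2 * ξ - |a * U ξ| := by linarith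
        _ ≤ |cω / 2 * ξ + a * U ξ| := by
            have := abs_add_le (cω / 2 * ξ + a * U ξ) (-(a * U ξ))
            rw [abs_neg, show cω / 2 * ξ + a * U ξ + -(a * U ξ) = cω / 2 * ξ by ring,
              abs_of_pos (by positivity : (0:ℝ) < cω / 2 * ξ)] at this
            linarith
    have hprod : |cω / 2 * ξ + a * U ξ| * |dOm ξ| ≤ (cω + Mh) * C / (1 + ξ ^ 2) := by
      rw [← abs_mul, heq, abs_neg]; exact hlin ξ
    have h3 : cω / 4 * ξ * |dOm ξ| ≤ (cω + Mh) * C / (1 + ξ ^ 2) :=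
      (mul_le_mul_of_nonneg_right hcoef (abs_nonneg _)).trans hprod
    have h4 : (cω + Mh) * C / (1 + ξ ^ 2) ≤ (cω + Mh) * C / ξ ^ 2 :=
      div_le_div_of_nonneg_left (by positivity) (by positivity) (by nlinarith)
    have h5 : cω / 4 * ξ * |dOm ξ| * ξ ^ 2 ≤ (cω + Mh) * C := by
      have h := h3.trans h4
      rwa [le_div_iff₀ (by positivity)] at h
    rw [div_div, le_div_iff₀ (by positivity)]
    calc |dOm ξ| * (cω * ξ ^ 2) ≤ |dOm ξ| * (cω * ξ ^ 2) * ξ := le_mul_of_one_le_right (by positivity) hξ1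
      _ = 4 * (cω / 4 * ξ * |dOm ξ| * ξ ^ 2) := by ring
      _ ≤ 4 * ((cω + Mh) * C) := by linarith
      _ = 4 * (cω + Mh) * C := by ring
  · -- `ε > 0`: two rounds of the Gaussian integrating factor
    set b : ℝ := cω / (4 * ε) with hb
    have hb0 : 0 < b := by positivity
    have h2bε : 2 * b * ε = cω / 2 := by rw [hb]; field_simp; ring
    set f : ℝ → ℝ := fun s => (cω - hilbertTransform Om s) * Om s + a * U s * dOm s with hf
    have hfc : ContinuousOn f (Ioi 0) :=
      ((continuous_const.sub hhc).mul hc).continuousOn.add ((continuousOn_const.mul hUc).mul hdc.continuousOn)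
    have heq : ∀ s ∈ Ioi (0:ℝ), ε * ddOm s = 2 * b * ε * (s * dOm s) + f s := by
      intro s hs
      rw [h2bε]
      exact nsTypeLine_eq_ddOm hF hs
    -- round 1: `|f| ≤ K₁`
    set K₁ : ℝ := (cω + Mh) * C + B * M with hK₁
    have hfK₁ : ∀ s ∈ Ioi (0:ℝ), |f s| ≤ K₁ / s ^ 0 := by
      intro s hs
      rw [pow_zero, div_one, hf]
      refine (abs_add_le _ _).trans (add_le_add ((hlin s).trans ?_) ?_)
      · exact div_le_self (by positivity) (by nlinarith)
      · rw [abs_mul]; exact mul_le_mul (hB s hs) (hM s) (abs_nonneg _) hB0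
    have hr1 := slope_round hb0 hεpos hdOm hM hfc heq hfK₁
    -- round 2: `|f| ≤ K₂/ξ`
    set K₂ : ℝ := (cω + Mh) * C / 2 + B * (K₁ / (2 * b * ε)) with hK₂
    have hfK₂ : ∀ s ∈ Ioi (0:ℝ), |f s| ≤ K₂ / s ^ 1 := by
      intro s hs
      have hs0 : (0:ℝ) < s := hs
      rw [pow_one, hf]
      refine (abs_add_le _ _).trans ?_
      have h1 : (cω + Mh) * C / (1 + s ^ 2) ≤ (cω + Mh) * C / 2 / s := by
        rw [div_div]
        exact div_le_div_of_nonneg_left (by positivity) (by positivity) (by nlinarith [sq_nonneg (s - 1)])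
      have h2 : |a * U s * dOm s| ≤ B * (K₁ / (2 * b * ε)) / s := by
        rw [abs_mul]
        have h3 := hr1 s hs
        rw [zero_add, pow_one] at h3
        calc |a * U s| * |dOm s| ≤ B * (K₁ / (2 * b * ε * s)) := mul_le_mul (hB s hs) h3 (abs_nonneg _) hB0
          _ = B * (K₁ / (2 * b * ε)) / s := by field_simp
      calc |(cω - hilbertTransform Om s) * Om s| + |a * U s * dOm s|
          ≤ (cω + Mh) * C / 2 / s + B * (K₁ / (2 * b * ε)) / s := add_le_add ((hlin s).trans h1) h2
        _ = K₂ / s := by rw [hK₂]; field_simp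
    have hr2 := slope_round hb0 hεpos hdOm hM hfc heq hfK₂
    refine conclude (K₂ / (2 * b * ε)) 0 fun ξ _ hξ0 => ?_
    have h := hr2 ξ hξ0
    calc |dOm ξ| ≤ K₂ / (2 * b * ε * ξ ^ (1 + 1)) := h
      _ = K₂ / (2 * b * ε) / ξ ^ 2 := by rw [div_div]

/-- **(D4) `ξΩ′(ξ) → 0` in the bare census class with velocity**, every `a`, every `ε ≥ 0` (`c_ω > 0`): the velocity is
bounded (`velocity_bounded`), then `decay_hdOm1_of_velocityBound`. [new here — MODEL] -/
theorem decay_hdOm1 {cω a ε M C : ℝ} {U Om dOm ddOm : ℝ → ℝ} (hcω : 0 < cω) (hε : 0 ≤ ε)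
    (hodd : ∀ y, Om (-y) = -Om y)
    (hOm : ∀ ξ, HasDerivAt Om (dOm ξ) ξ) (hdOm : ∀ ξ, HasDerivAt dOm (ddOm ξ) ξ)
    (hM : ∀ y, |dOm y| ≤ M) (hC : ∀ y, |Om y| ≤ C / (1 + y ^ 2))
    (hU : ∀ ξ, HasDerivAt U (hilbertTransform Om ξ) ξ) (hU0 : U 0 = 0)
    (hF : ∀ ξ ∈ Ioi (0:ℝ), F1 cω (cω / 2) a 1 ε (hilbertTransform Om) U Om dOm ddOm (fun _ => 0) ξ = 0) :
    Tendsto (fun R => R * dOm R) atTop (𝓝 0) := by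
  have hdc : Continuous dOm := continuous_iff_continuousAt.mpr fun x => (hdOm x).continuousAt
  obtain ⟨B, hB0, hB⟩ := velocity_bounded hodd hOm hdc hC hU hU0
  have hUc : Continuous U := continuous_iff_continuousAt.mpr fun x => (hU x).continuousAt
  refine decay_hdOm1_of_velocityBound (B := |a| * B) hcω hε hOm hdOm hM hC hUc.continuousOn (fun s _ => ?_) hF
  rw [abs_mul]; exact mul_le_mul_of_nonneg_left (hB s) (abs_nonneg _)

/-- **(D4₀) `ξΩ′(ξ) → 0` at the CLM point `a = 0`, VELOCITY-FREE** (`𝒰` arbitrary: its coefficient is `a = 0`),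
every `ε ≥ 0`, `c_ω > 0`. [new here — MODEL] -/
theorem decay_hdOm1_of_a_eq_zero {cω ε M C : ℝ} {U Om dOm ddOm : ℝ → ℝ} (hcω : 0 < cω) (hε : 0 ≤ ε)
    (hOm : ∀ ξ, HasDerivAt Om (dOm ξ) ξ) (hdOm : ∀ ξ, HasDerivAt dOm (ddOm ξ) ξ)
    (hM : ∀ y, |dOm y| ≤ M) (hC : ∀ y, |Om y| ≤ C / (1 + y ^ 2))
    (hF : ∀ ξ ∈ Ioi (0:ℝ), F1 cω (cω / 2) 0 1 ε (hilbertTransform Om) U Om dOm ddOm (fun _ => 0) ξ = 0) :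
    Tendsto (fun R => R * dOm R) atTop (𝓝 0) := by
  -- replace `𝒰` by `0`: the `a = 0` equation does not see it
  have hF' : ∀ ξ ∈ Ioi (0:ℝ), F1 cω (cω / 2) 0 1 ε (hilbertTransform Om) (fun _ => 0) Om dOm ddOm (fun _ => 0) ξ = 0 := by
    intro ξ hξ
    have h := hF ξ hξ
    simp only [F1] at h ⊢
    linarith
  exact decay_hdOm1_of_velocityBound (B := 0) hcω hε hOm hdOm hM hC continuousOn_const
    (fun s _ => by simp) hF'

end SheetHalfLine
end Summit.NavierStokesRegularity.OSWSelfSimilar
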